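import Mathlib
import Literature.Computability.AlgebraicComplexity.ApolarityAction
import Literature.Computability.AlgebraicComplexity.LinSubst
import Literature.Computability.Complexity.OccurrenceObstructionsBIP
import Summits.ValiantsHypothesis.ValiantsHypothesis.Theorems.ValuativeGCTValuativeFlipCatalecticantPadding

/-!
# The shifted-partials bound for corner minors of the catalecticant of `ℓ^p · G`

Crux `ValuativeGCT.ValuativeFlip` (stmt-ValiantsHypothesis-12624), wall-breaker axis
"explicit padded-permanent highest-weight vectors for seedRichness" (k5 gen 1, seat 3), part 4.

Part 2 killed the corner minors of `Cat(ℓ^p G)` with row degree `a < p`.  For `a = p + t ≥ p` the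
Leibniz expansion has a leading, `ℓ`-free part: for a monomial operator `∂^ρ`, `|ρ| = p + t`,
`∂^ρ(ℓ^p G) ∈ Σ_{u=0}^{p} ℓ^u · span{∂^κ G : κ ≤ ρ, |κ| = t + u}`
(`apolarAction_monomial_mem_filtration`, by induction on `ρ` one derivative at a time: `∂_i` moves
`ℓ^u ∂^κ G` to `u c_i ℓ^{u-1} ∂^κ G + ℓ^u ∂^{κ+e_i} G`, `c_i = ∂_i ℓ ∈ k`).  Reading coefficients on
the column segment `V₂` (degree `b`): the levels `u ≥ 1` are multiples of `ℓ` and contribute vectors in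
the span of the `#UpIdx σ (b-1) i₂` fixed vectors of part 2, the level `u = 0` contributes the
coefficient vectors of the `∂^κ G`, `κ ∈ Mon_t(V₁)` — at most `#UpIdx σ t i₁` more.  Hence
(`det_catMinorMat_eq_zero_of_card_lt`):
  `#UpIdx σ (b-1) i₂ + #UpIdx σ t i₁ < #UpIdx σ b i₂ = D  ⇒  det Cat(ℓ^p G)_{p+t, b; i₁, i₂} = 0`,
i.e. in binomials `C(N₂+b-2, b-1) + C(N₁+t-1, t) < C(N₂+b-1, b)`, i.e. `C(N₁+t-1, t) < C(N₂+b-2, b)`.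
For the padded permanent (`p = m - n`, `det_catMinorMat_paddedPer_eq_zero_of_card_lt`) this — together
with its transpose (column) form — is EXACTLY the alive/dead pattern of the small-case census of
`Cruxes/ValuativeFlip/AxisK5G1S3CatalecticantShapes.md` (`(n,m) ∈ {(2,3),(2,4),(3,4),(3,5),(3,6),(4,5),(4,6)}`,
all 172 corners with `D ≤ 130` and segments of `≤ 7` variables, 48 of them with `D > 1`: the 35 dead
corners are precisely those with `min(row bound, column bound) < D`, and the rank equals that bound in
26 of the 35).
This is the "shifted partial derivatives versus padding" phenomenon of Efremenko–Landsberg–Schenck–Weyman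
for the corner-minor family.  [Iarrobino–Kanev LNM 1721 §1.1; Efremenko–Landsberg–Schenck–Weyman 2018; folklore]
-/

set_option linter.dupNamespace false

namespace Summit.ValiantsHypothesis.ValiantsHypothesis.Theorems.ValuativeFlip

open MvPolynomial
open scoped BigOperators Matrix
open Literature.Computability.AlgebraicComplexity
open Literature.Computability.Complexity
open Literature.NumberTheory.DiophantineGeometry

noncomputable section

/-! ### Stars and bars: `#UpIdx σ c i₀ = C(N + c - 1, c)` -/

section Cardinality

variable {σ : Type*} [Fintype σ] [LinearOrder σ]

omit [Fintype σ] [LinearOrder σ] in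
/-- The degree of a finitely supported function is the degree of its restriction to a set
containing its support. [folklore] -/
theorem degree_subtypeDomain_of_support_subset {S : Set σ} [DecidablePred (· ∈ S)] (f : σ →₀ ℕ)
    (hf : ↑f.support ⊆ S) : (f.subtypeDomain (· ∈ S)).degree = f.degree := by
  rw [Finsupp.degree_apply, Finsupp.degree_apply, Finsupp.support_subtypeDomain]
  simp only [Finsupp.subtypeDomain_apply]
  rw [Finset.sum_subtype_eq_sum_filter (f := fun x => f x),
    Finset.filter_true_of_mem (fun x hx => hf (Finset.mem_coe.mpr hx))]

/-- **Stars and bars for final-segment monomials**: `#UpIdx σ c i₀ = C(N + c - 1, c)`, `N` the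
number of variables `≥ i₀` (so the cardinality criteria of this file read in binomials).
[folklore] -/
theorem card_upIdx_eq_choose (c : ℕ) (i₀ : σ) :
    Fintype.card (UpIdx σ c i₀) = (Fintype.card {l : σ // i₀ ≤ l} + c - 1).choose c := by
  classical
  set S : Set σ := {l | i₀ ≤ l} with hS
  have hcardS : Fintype.card {l : σ // i₀ ≤ l} = Fintype.card S := rfl
  rw [hcardS, ← Sym.card_sym_eq_choose]
  refine Fintype.card_congr ?_
  -- `UpIdx` as a subtype of the support-restricted finsupps
  let E1 : UpIdx σ c i₀ ≃ {f : {f : σ →₀ ℕ // ↑f.support ⊆ S} // f.1.degree = c} :=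
    { toFun := fun r => ⟨⟨r.vec, fun i hi => r.supp i (Finset.mem_coe.mp hi)⟩, degree_upIdx_vec r⟩
      invFun := fun f => ⟨⟨f.1.1, mem_degMonomials_iff.mpr f.2⟩, fun i hi => f.1.2 (Finset.mem_coe.mpr hi)⟩
      left_inv := fun r => rfl
      right_inv := fun f => rfl }
  -- restrict the domain to the segment
  let E2 : {f : {f : σ →₀ ℕ // ↑f.support ⊆ S} // f.1.degree = c} ≃ {g : S →₀ ℕ // g.degree = c} :=
    (Finsupp.restrictSupportEquiv S ℕ).subtypeEquiv fun f => by
      rw [Finsupp.restrictSupportEquiv_apply, degree_subtypeDomain_of_support_subset f.1 f.2]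
  -- finsupps of degree `c` are the multisets of size `c`
  let E3 : {g : S →₀ ℕ // g.degree = c} ≃ Sym S c :=
    Multiset.toFinsupp.symm.toEquiv.subtypeEquiv fun g => by
      change g.degree = c ↔ Multiset.card (Finsupp.toMultiset g) = c
      rw [Finsupp.card_toMultiset, Finsupp.degree_apply]
      rfl
  exact E1.trans (E2.trans E3)

end Cardinality

/-! ### The Leibniz filtration of `∂^ρ (ℓ^p G)` -/

section Filtration

variable {σ : Type*} {k : Type*} [Field k]

/-- One more derivative of a generator: `∂_i (∂^κ G) = ∂^{κ + e_i} G`. [folklore] -/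
theorem pderiv_apolarAction_monomial (i : σ) (κ : σ →₀ ℕ) (G : MvPolynomial σ k) :
    pderiv i (apolarAction (monomial κ (1 : k)) G) = apolarAction (monomial (κ + Finsupp.single i 1) (1 : k)) G := by
  rw [add_comm, monomial_single_add, pow_one, apolarAction_mul, apolarAction_X]

/-- **One derivative moves down the filtration.**  If `x ∈ Σ_u ℓ^u · span{∂^κ G : κ ≤ ρ, |κ|+p = |ρ|+u}`
then `∂_i x` lies in the same filtration for `ρ + e_i` (`∂_i ℓ = c_i` a constant). [folklore] -/
theorem pderiv_mem_filtration {ℓ G : MvPolynomial σ k} (c : σ → k) (hc : ∀ i, pderiv i ℓ = C (c i))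
    (p : ℕ) (ρ : σ →₀ ℕ) (i : σ) {x : MvPolynomial σ k}
    (hx : x ∈ ⨆ u : Fin (p + 1), (Submodule.span k {g | ∃ κ : σ →₀ ℕ, κ ≤ ρ ∧ κ.degree + p = ρ.degree + (u : ℕ) ∧
        g = apolarAction (monomial κ (1 : k)) G}).map (LinearMap.mulLeft k (ℓ ^ (u : ℕ)))) :
    pderiv i x ∈ ⨆ u : Fin (p + 1), (Submodule.span k {g | ∃ κ : σ →₀ ℕ, κ ≤ ρ + Finsupp.single i 1 ∧
        κ.degree + p = (ρ + Finsupp.single i 1).degree + (u : ℕ) ∧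
        g = apolarAction (monomial κ (1 : k)) G}).map (LinearMap.mulLeft k (ℓ ^ (u : ℕ))) := by
  classical
  -- name the target filtration
  set F' : Fin (p + 1) → Submodule k (MvPolynomial σ k) := fun u =>
    (Submodule.span k {g | ∃ κ : σ →₀ ℕ, κ ≤ ρ + Finsupp.single i 1 ∧
        κ.degree + p = (ρ + Finsupp.single i 1).degree + (u : ℕ) ∧
        g = apolarAction (monomial κ (1 : k)) G}).map (LinearMap.mulLeft k (ℓ ^ (u : ℕ))) with hF'
  change pderiv i x ∈ ⨆ u, F' u
  induction hx using Submodule.iSup_induction' with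
  | zero => rw [map_zero]; exact Submodule.zero_mem _
  | add x y _ _ hx hy => rw [map_add]; exact Submodule.add_mem _ hx hy
  | mem u x hx =>
    obtain ⟨w, hw, rfl⟩ := Submodule.mem_map.mp hx
    clear hx
    simp only [LinearMap.mulLeft_apply]
    -- reduce to generators of the span by linearity in `w`
    induction hw using Submodule.span_induction with
    | zero => rw [mul_zero, map_zero]; exact Submodule.zero_mem _
    | add w w' _ _ hw hw' => rw [mul_add, map_add]; exact Submodule.add_mem _ hw hw'
    | smul a w _ hw => rw [mul_smul_comm, Derivation.map_smul]; exact Submodule.smul_mem _ a hw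
    | mem w hw =>
      obtain ⟨κ, hκρ, hdeg, rfl⟩ := hw
      rw [Derivation.leibniz, Derivation.leibniz_pow, hc i, pderiv_apolarAction_monomial]
      simp only [smul_eq_mul]
      refine Submodule.add_mem _ ?_ ?_
      · -- `ℓ^u · ∂^{κ+e_i} G` : same level `u`
        refine Submodule.mem_iSup_of_mem u (Submodule.mem_map.mpr ⟨_, Submodule.subset_span
          ⟨κ + Finsupp.single i 1, add_le_add hκρ le_rfl, ?_, rfl⟩, rfl⟩)
        rw [map_add, map_add, Finsupp.degree_single]
        omega
      · -- `u c_i ℓ^{u-1} · ∂^κ G` : level `u - 1` (vanishes for `u = 0`)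
        rcases Nat.eq_zero_or_pos (u : ℕ) with hu0 | hupos
        · rw [hu0, zero_smul, mul_zero]
          exact Submodule.zero_mem _
        · have hu1 : (u : ℕ) - 1 < p + 1 := by omega
          refine Submodule.mem_iSup_of_mem ⟨(u : ℕ) - 1, hu1⟩ (Submodule.mem_map.mpr
            ⟨((u : ℕ) • c i) • apolarAction (monomial κ (1 : k)) G,
             Submodule.smul_mem _ _ (Submodule.subset_span ⟨κ, hκρ.trans le_self_add, ?_, rfl⟩), ?_⟩)
          · rw [map_add, Finsupp.degree_single]
            simp only
            omega
          · simp only [LinearMap.mulLeft_apply, smul_eq_C_mul, nsmul_eq_mul, map_mul, map_natCast]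
            ring
  
/-- Iterating: `x ∈ Filt(ρ) ⇒ ∂_i^e x ∈ Filt(ρ + e·e_i)`. [folklore] -/
theorem apolarAction_X_pow_mem_filtration {ℓ G : MvPolynomial σ k} (c : σ → k) (hc : ∀ i, pderiv i ℓ = C (c i))
    (p : ℕ) (ρ : σ →₀ ℕ) (i : σ) (e : ℕ) {x : MvPolynomial σ k}
    (hx : x ∈ ⨆ u : Fin (p + 1), (Submodule.span k {g | ∃ κ : σ →₀ ℕ, κ ≤ ρ ∧ κ.degree + p = ρ.degree + (u : ℕ) ∧
        g = apolarAction (monomial κ (1 : k)) G}).map (LinearMap.mulLeft k (ℓ ^ (u : ℕ)))) :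
    apolarAction (X i ^ e) x ∈ ⨆ u : Fin (p + 1), (Submodule.span k {g | ∃ κ : σ →₀ ℕ, κ ≤ ρ + Finsupp.single i e ∧
        κ.degree + p = (ρ + Finsupp.single i e).degree + (u : ℕ) ∧
        g = apolarAction (monomial κ (1 : k)) G}).map (LinearMap.mulLeft k (ℓ ^ (u : ℕ))) := by
  induction e with
  | zero =>
    rw [pow_zero, ← C_1, apolarAction_C, one_smul]
    simpa only [Finsupp.single_zero, add_zero] using hx
  | succ e ih =>
    rw [pow_succ', apolarAction_mul, apolarAction_X]
    have h := pderiv_mem_filtration c hc p (ρ + Finsupp.single i e) i ih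
    simpa only [add_assoc, ← Finsupp.single_add] using h

/-- **The Leibniz filtration.**  For `ℓ` with constant first derivatives (`∂_i ℓ = c_i`), every `G`,
`p` and monomial operator `∂^ρ`:
`∂^ρ (ℓ^p G) ∈ Σ_{u=0}^{p} ℓ^u · span{∂^κ G : κ ≤ ρ, |κ| + p = |ρ| + u}` — the level `u = 0` is the
`ℓ`-free leading part `span{∂^κ G : κ ≤ ρ, |κ| = |ρ| - p}` (empty when `|ρ| < p`). [folklore] -/
theorem apolarAction_monomial_mem_filtration {ℓ G : MvPolynomial σ k} (c : σ → k) (hc : ∀ i, pderiv i ℓ = C (c i))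
    (p : ℕ) (ρ : σ →₀ ℕ) :
    apolarAction (monomial ρ (1 : k)) (ℓ ^ p * G) ∈
      ⨆ u : Fin (p + 1), (Submodule.span k {g | ∃ κ : σ →₀ ℕ, κ ≤ ρ ∧ κ.degree + p = ρ.degree + (u : ℕ) ∧
        g = apolarAction (monomial κ (1 : k)) G}).map (LinearMap.mulLeft k (ℓ ^ (u : ℕ))) := by
  classical
  induction ρ using Finsupp.induction with
  | zero =>
    rw [← C_apply, apolarAction_C, one_smul]
    refine Submodule.mem_iSup_of_mem ⟨p, Nat.lt_succ_self p⟩ (Submodule.mem_map.mpr ⟨G, Submodule.subset_span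
      ⟨0, le_rfl, by simp, ?_⟩, rfl⟩)
    rw [← C_apply, apolarAction_C, one_smul]
  | single_add i e ρ' _ _ ih =>
    rw [monomial_single_add, apolarAction_mul, add_comm (Finsupp.single i e) ρ']
    exact apolarAction_X_pow_mem_filtration c hc p ρ' i e ih

end Filtration

/-! ### The rank bound and the vanishing criterion -/

section Criterion

variable {σ : Type*} [Fintype σ] [LinearOrder σ] {k : Type*} [Field k]

/-- **Rows of the corner block of `Cat(ℓ^p G)` in row degree `p + t`** lie in the sum of the span of the
`#UpIdx σ (b-1) i₂` fixed vectors `γ ↦ coeff_γ(ℓ X^ν)` (the `ℓ`-multiples) and the span of the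
`#UpIdx σ t i₁` coefficient vectors `γ ↦ coeff_γ(∂^κ G)`, `κ ∈ Mon_t(V₁)` (the leading part). [folklore] -/
theorem catMinorMat_row_mem_sup {ℓ G : MvPolynomial σ k} (hℓ : ℓ.IsHomogeneous 1) (c : σ → k)
    (hc : ∀ i, pderiv i ℓ = C (c i)) (p t b : ℕ) (i₁ i₂ : σ) (e : UpIdx σ (p + t) i₁ ≃ UpIdx σ b i₂)
    (r : UpIdx σ (p + t) i₁) :
    catMinorMat (p + t) b i₁ i₂ e (ℓ ^ p * G) r ∈
      Submodule.span k (Set.range fun ν : UpIdx σ (b - 1) i₂ => fun r' : UpIdx σ (p + t) i₁ =>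
          coeff (e r').vec (ℓ * monomial ν.vec 1)) ⊔
      Submodule.span k (Set.range fun κ : UpIdx σ t i₁ => fun r' : UpIdx σ (p + t) i₁ =>
          coeff (e r').vec (apolarAction (monomial κ.vec (1 : k)) G)) := by
  classical
  -- the coefficient-vector map (linear)
  set VEC : MvPolynomial σ k →ₗ[k] (UpIdx σ (p + t) i₁ → k) :=
    { toFun := fun f r' => coeff (e r').vec f
      map_add' := fun f g => funext fun r' => coeff_add _ _ _
      map_smul' := fun a f => funext fun r' => by simp [coeff_smul] } with hVEC
  have hrow : catMinorMat (p + t) b i₁ i₂ e (ℓ ^ p * G) r = VEC (apolarAction (monomial r.vec (1 : k)) (ℓ ^ p * G)) := by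
    funext r'
    rw [catMinorMat_apply, catMat_apply]
    rfl
  rw [hrow]
  have hmem := apolarAction_monomial_mem_filtration (G := G) c hc p r.vec
  set T := Submodule.span k (Set.range fun ν : UpIdx σ (b - 1) i₂ => fun r' : UpIdx σ (p + t) i₁ =>
          coeff (e r').vec (ℓ * monomial ν.vec 1)) ⊔
      Submodule.span k (Set.range fun κ : UpIdx σ t i₁ => fun r' : UpIdx σ (p + t) i₁ =>
          coeff (e r').vec (apolarAction (monomial κ.vec (1 : k)) G)) with hT
  suffices hall : ∀ x, x ∈ (⨆ u : Fin (p + 1), (Submodule.span k {g | ∃ κ : σ →₀ ℕ, κ ≤ r.vec ∧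
      κ.degree + p = r.vec.degree + (u : ℕ) ∧ g = apolarAction (monomial κ (1 : k)) G}).map
        (LinearMap.mulLeft k (ℓ ^ (u : ℕ)))) → VEC x ∈ T from hall _ hmem
  intro x hx
  induction hx using Submodule.iSup_induction' with
  | zero => rw [map_zero]; exact Submodule.zero_mem _
  | add x y _ _ hx hy => rw [map_add]; exact Submodule.add_mem _ hx hy
  | mem u x hx =>
    obtain ⟨w, hw, rfl⟩ := Submodule.mem_map.mp hx
    clear hx
    simp only [LinearMap.mulLeft_apply]
    rcases Nat.eq_zero_or_pos (u : ℕ) with hu0 | hupos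
    · -- the leading level: `w ∈ span{∂^κ G : κ ≤ ρ, |κ| = t}`
      rw [hu0, pow_zero, one_mul]
      refine Submodule.mem_sup_right ?_
      induction hw using Submodule.span_induction with
      | zero => rw [map_zero]; exact Submodule.zero_mem _
      | add w w' _ _ hw hw' => rw [map_add]; exact Submodule.add_mem _ hw hw'
      | smul a w _ hw => rw [map_smul]; exact Submodule.smul_mem _ a hw
      | mem w hw =>
        obtain ⟨κ, hκρ, hdeg, rfl⟩ := hw
        have hκdeg : κ.degree = t := by
          have := degree_upIdx_vec r
          rw [hu0] at hdeg
          omega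
        have hκsupp : ∀ i ∈ κ.support, i₁ ≤ i := fun i hi => r.supp i (Finsupp.support_mono hκρ hi)
        refine Submodule.subset_span ⟨⟨⟨κ, mem_degMonomials_iff.mpr hκdeg⟩, hκsupp⟩, ?_⟩
        rfl
    · -- the `ℓ`-multiples: `ℓ^u w = ℓ · (ℓ^{u-1} w)`
      refine Submodule.mem_sup_left ?_
      obtain ⟨u', hu'⟩ : ∃ u', (u : ℕ) = u' + 1 := ⟨(u : ℕ) - 1, by omega⟩
      rw [hu', pow_succ', mul_assoc]
      have hexp := coeffVec_mul_eq_sum hℓ b i₂ (ℓ ^ u' * w)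
      have hfun : VEC (ℓ * (ℓ ^ u' * w)) = ∑ ν : UpIdx σ (b - 1) i₂, coeff ν.vec (ℓ ^ u' * w) •
          (fun r' : UpIdx σ (p + t) i₁ => coeff (e r').vec (ℓ * monomial ν.vec 1)) := by
        funext r'
        have h1 := congrFun hexp (e r')
        simp only [Finset.sum_apply, Pi.smul_apply, smul_eq_mul] at h1 ⊢
        exact h1
      rw [hfun]
      exact Submodule.sum_mem _ fun ν _ => Submodule.smul_mem _ _ (Submodule.subset_span ⟨ν, rfl⟩)

/-- **The shifted-partials vanishing criterion.**  For `ℓ` linear (homogeneous of degree `1` with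
constant first derivatives), any `G`, row degree `p + t` and column degree `b`:
if `#UpIdx σ (b-1) i₂ + #UpIdx σ t i₁ < #UpIdx σ b i₂` then `det Cat(ℓ^p G)_{p+t,b;i₁,i₂} = 0`
(`D` rows in a space of dimension `< D`). In binomials: `C(N₁+t-1,t) < C(N₂+b-2,b)`.
Efremenko–Landsberg–Schenck–Weyman 2018 (method of shifted partials vs padding). [folklore] -/
theorem det_catMinorMat_eq_zero_of_card_lt {ℓ G : MvPolynomial σ k} (hℓ : ℓ.IsHomogeneous 1) (c : σ → k)
    (hc : ∀ i, pderiv i ℓ = C (c i)) (p t b : ℕ) (i₁ i₂ : σ) (e : UpIdx σ (p + t) i₁ ≃ UpIdx σ b i₂)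
    (hlt : Fintype.card (UpIdx σ (b - 1) i₂) + Fintype.card (UpIdx σ t i₁) < Fintype.card (UpIdx σ b i₂)) :
    (catMinorMat (p + t) b i₁ i₂ e (ℓ ^ p * G)).det = 0 := by
  classical
  set M := catMinorMat (p + t) b i₁ i₂ e (ℓ ^ p * G) with hM
  set A := Submodule.span k (Set.range fun ν : UpIdx σ (b - 1) i₂ => fun r' : UpIdx σ (p + t) i₁ =>
          coeff (e r').vec (ℓ * monomial ν.vec 1)) with hA
  set B := Submodule.span k (Set.range fun κ : UpIdx σ t i₁ => fun r' : UpIdx σ (p + t) i₁ =>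
          coeff (e r').vec (apolarAction (monomial κ.vec (1 : k)) G)) with hB
  have hrow : ∀ r, M r ∈ A ⊔ B := fun r => catMinorMat_row_mem_sup hℓ c hc p t b i₁ i₂ e r
  by_contra hdet
  have hU : IsUnit M := (Matrix.isUnit_iff_isUnit_det M).mpr (isUnit_iff_ne_zero.mpr hdet)
  have hli : LinearIndependent k M.row := Matrix.linearIndependent_rows_iff_isUnit.mpr hU
  have hcard := linearIndependent_iff_card_eq_finrank_span.mp hli
  have hle : Submodule.span k (Set.range M.row) ≤ A ⊔ B :=
    Submodule.span_le.mpr (Set.range_subset_iff.mpr fun r => hrow r)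
  have h1 : (Set.range M.row).finrank k ≤ Module.finrank k ↥(A ⊔ B) := Submodule.finrank_mono hle
  have h2 : Module.finrank k ↥(A ⊔ B) ≤ Module.finrank k ↥A + Module.finrank k ↥B :=
    Submodule.finrank_add_le_finrank_add_finrank A B
  have hA' : Module.finrank k ↥A ≤ Fintype.card (UpIdx σ (b - 1) i₂) := finrank_range_le_card _
  have hB' : Module.finrank k ↥B ≤ Fintype.card (UpIdx σ t i₁) := finrank_range_le_card _
  have h4 : Fintype.card (UpIdx σ (p + t) i₁) = Fintype.card (UpIdx σ b i₂) := Fintype.card_congr e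
  omega

end Criterion

/-! ### The padded permanent -/

section Padded

/-- The linear form `A · X₀₀` has constant first derivatives `A_{i,(0,0)}`. [folklore] -/
theorem pderiv_linSubst_X {m : ℕ} (A : Matrix (MatIdx m) (MatIdx m) ℂ) (q i : MatIdx m) :
    pderiv i (linSubst (MatIdx m) ℂ A (X q)) = C (A i q) := by
  classical
  rw [linSubst_X, map_sum, Finset.sum_eq_single i]
  · rw [Derivation.map_smul, pderiv_X, Pi.single_eq_same, smul_eq_C_mul, mul_one]
  · intro j _ hj
    rw [Derivation.map_smul, pderiv_X, Pi.single_eq_of_ne hj, smul_zero]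
  · intro h; exact absurd (Finset.mem_univ i) h

/-- **The shifted-partials criterion for `End · (X₀₀^{m-n} per_n)`.**  For row degree `m - n + t`
and column degree `b`, if `#UpIdx (b-1) i₂ + #UpIdx t i₁ < #UpIdx b i₂` (in binomials
`C(N₁+t-1, t) < C(N₂+b-2, b)`), then the corner minor of the catalecticant vanishes at `A · pp` for
EVERY matrix `A`.  With its column form this reproduces exactly the alive/dead pattern of the
small-case census (module docstring). [this crux (AxisK5G1S3); Efremenko–Landsberg–Schenck–Weyman 2018; folklore] -/
theorem det_catMinorMat_paddedPer_eq_zero_of_card_lt (n m t b : ℕ) [NeZero m] (i₁ i₂ : MatIdx m)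
    (e : UpIdx (MatIdx m) (m - n + t) i₁ ≃ UpIdx (MatIdx m) b i₂) (A : Matrix (MatIdx m) (MatIdx m) ℂ)
    (hlt : Fintype.card (UpIdx (MatIdx m) (b - 1) i₂) + Fintype.card (UpIdx (MatIdx m) t i₁) <
      Fintype.card (UpIdx (MatIdx m) b i₂)) :
    (catMinorMat (m - n + t) b i₁ i₂ e (linSubst (MatIdx m) ℂ A (paddedPerFormLex ℂ n m))).det = 0 := by
  rw [paddedPerFormLex_eq, map_mul, map_pow]
  refine det_catMinorMat_eq_zero_of_card_lt ?_ (fun i => A i (toLex ((0 : Fin m), (0 : Fin m))))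
    (fun i => pderiv_linSubst_X A _ i) (m - n) t b i₁ i₂ e hlt
  rw [linSubst_X]
  exact IsHomogeneous.sum _ _ _ fun l _ => by
    rw [smul_eq_C_mul]; exact (isHomogeneous_X ℂ l).C_mul _

/-- **The criterion in binomials**: with `N₁`, `N₂` the numbers of variables `≥ i₁`, `≥ i₂`, row degree
`m - n + t`, column degree `b`: `C(N₂+b-2, b-1) + C(N₁+t-1, t) < C(N₂+b-1, b)` (for `b ≥ 1` this is
`C(N₁+t-1, t) < C(N₂+b-2, b)`) forces the corner minor to vanish on `End · (X₀₀^{m-n} per_n)`.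
[this crux (AxisK5G1S3); folklore] -/
theorem det_catMinorMat_paddedPer_eq_zero_of_choose_lt (n m t b : ℕ) [NeZero m] (i₁ i₂ : MatIdx m)
    (e : UpIdx (MatIdx m) (m - n + t) i₁ ≃ UpIdx (MatIdx m) b i₂) (A : Matrix (MatIdx m) (MatIdx m) ℂ)
    (hlt : (Fintype.card {l : MatIdx m // i₂ ≤ l} + (b - 1) - 1).choose (b - 1) +
        (Fintype.card {l : MatIdx m // i₁ ≤ l} + t - 1).choose t <
      (Fintype.card {l : MatIdx m // i₂ ≤ l} + b - 1).choose b) :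
    (catMinorMat (m - n + t) b i₁ i₂ e (linSubst (MatIdx m) ℂ A (paddedPerFormLex ℂ n m))).det = 0 := by
  refine det_catMinorMat_paddedPer_eq_zero_of_card_lt n m t b i₁ i₂ e A ?_
  rwa [card_upIdx_eq_choose, card_upIdx_eq_choose, card_upIdx_eq_choose]

/-- **Registered form** (stub `catMinor_paddedPer_shifted` of stmt-ValiantsHypothesis-12624, one-line
`∀` signature). [this crux; folklore] -/
theorem catMinor_paddedPer_shifted :
    ∀ (n m t b : ℕ) [NeZero m] (i₁ i₂ : MatIdx m) (e : UpIdx (MatIdx m) (m - n + t) i₁ ≃ UpIdx (MatIdx m) b i₂) (A : Matrix (MatIdx m) (MatIdx m) ℂ), Fintype.card (UpIdx (MatIdx m) (b - 1) i₂) + Fintype.card (UpIdx (MatIdx m) t i₁) < Fintype.card (UpIdx (MatIdx m) b i₂) → (catMinorMat (m - n + t) b i₁ i₂ e (linSubst (MatIdx m) ℂ A (paddedPerFormLex ℂ n m))).det = 0 :=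
  fun n m t b _ i₁ i₂ e A hlt => det_catMinorMat_paddedPer_eq_zero_of_card_lt n m t b i₁ i₂ e A hlt

end Padded

end

end Summit.ValiantsHypothesis.ValiantsHypothesis.Theorems.ValuativeFlip
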